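import Literature.MathematicalPhysics.QuantumFieldTheory.ONMixedSumRule

/-!
# The `O(2)` crossing system of the three scalars `s, φ, t` (charges `0, 1, 2`): the seven crossing
# vectors, the functional conditions, and the external-scalar form `V⃗_ext` with its `ℝP³` scan
# (Chester–Landry–Liu–Poland–Simmons-Duffin–Su–Vichi, JHEP 06 (2020) 142, §2.1, §3.1–§3.3, App. «Crossing vectors»)

Topic `MathematicalPhysics/QuantumFieldTheory`; definitions + theorems only (no named fact, no instance,
no `sorry`), on top of `ONVectorSumRule.lean` (`F_∓`) and `ONMixedSumRule.lean` (the `O(N)` `{φ_i, s}`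
system of Kos–Poland–Simmons-Duffin–Vichi 2015, used here only for a kernel-checked cross-identification at
`N = 2`).  As there, this is finite-dimensional algebra over OPAQUE channel functions ("conformal blocks")
`g : ℝ → ℝ → ℝ` of the cross-ratios: nothing is asserted about what a block is, no CFT is constructed, and a
hypothetical spectrum is encoded by the index types of the families that are summed.

SOURCE, §2.1 (arXiv:1912.03324).  Externals: *"the lowest dimension scalar operators transforming in the
`0⁺`, `1`, and `2` representations, which we will denote … as `s`, `φ`, and `t`"*; *"The singlet `S`,
traceless symmetric `T`, vector `V` and antisymmetric `A` irreps considered in previous `O(N)` bootstrap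
papers correspond for `O(2)` to the `0⁺`, `2`, `1`, and `0⁻` irreps"*.  The block expansion (with the
source's explicit sign) *"`Σ_𝒪 (−1)^ℓ λ_{12𝒪} λ_{34𝒪} T^{R}(y_i) g^{Δ₁₂,Δ₃₄}_{Δ,ℓ}(u,v)`"*, blocks *"normalized as
in the second line of table 1 in [Poland–Rychkov–Vichi 2019]"*.  The crossing equations:
*"`Σ_{0⁺,ℓ⁺} (λ_{ss𝒪} λ_{φφ𝒪} λ_{tt𝒪}) V⃗_{0⁺,Δ,ℓ⁺} (λ_{ss𝒪}; λ_{φφ𝒪}; λ_{tt𝒪})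
 + Σ_{0⁻,ℓ⁻} (λ_{φφ𝒪} λ_{tt𝒪}) V⃗_{0⁻,Δ,ℓ⁻} (λ_{φφ𝒪}; λ_{tt𝒪}) + Σ_{1,ℓ^±} (λ_{φs𝒪} λ_{tφ𝒪}) V⃗_{1,Δ,ℓ} (λ_{φs𝒪}; λ_{tφ𝒪})
 + Σ_{2,ℓ⁺} (λ_{φφ𝒪} λ_{ts𝒪}) V⃗_{2,Δ,ℓ⁺} (λ_{φφ𝒪}; λ_{ts𝒪}) + Σ_{2,ℓ⁻} λ²_{ts𝒪} V⃗_{2,Δ,ℓ⁻} + Σ_{3,ℓ^±} λ²_{tφ𝒪} V⃗_{3,Δ,ℓ}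
 + Σ_{4,ℓ⁺} λ²_{tt𝒪} V⃗_{4,Δ,ℓ⁺} = 0`, where `ℓ^±` denotes which spins appear, and the `V⃗`'s are 22-dimensional
vectors of matrix or scalar crossing equations … written in terms of
`F^{ij,kl}_{∓,Δ,ℓ}(u,v) = v^{(Δ_k+Δ_j)/2} g^{Δ_ij,Δ_kl}_{Δ,ℓ}(u,v) ∓ u^{(Δ_k+Δ_j)/2} g^{Δ_ij,Δ_kl}_{Δ,ℓ}(v,u)`.  The
explicit form of the `V⃗`'s are given in appendix"* «Crossing vectors» — typed row by row below (`V0p`, `V0m`,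
`V1`, `V2p`, `V2m`, `V3`, `V4`; 22 rows each, the printed symmetric matrices with the printed entries on
BOTH sides of the diagonal; the one entry printed `F_{+,Δ,Jℓ}` in row 3 of `V⃗_{2,Δ,ℓ⁺}` is read `F_{+,Δ,ℓ}`).

SOURCE, §3.1.  *"We search for a linear functional `α` such that `α(V⃗_{0⁺,Δ,ℓ⁺}) ⪰ 0`, `α(V⃗_{0⁻,Δ,ℓ⁻}) ⪰ 0`,
`α(V⃗_{1,Δ,ℓ}) ⪰ 0`, `α(V⃗_{2,Δ,ℓ⁺}) ⪰ 0`, `α(V⃗_{2,Δ,ℓ⁻}) ≥ 0`, `α(V⃗_{3,Δ,ℓ}) ≥ 0`, `α(V⃗_{4,Δ,ℓ⁺}) ≥ 0`, for all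
combinations of representations, dimensions `Δ`, and even or odd spins `ℓ` in some hypothetical spectrum.
Here, "`M ⪰ 0`" means "`M` is positive-semidefinite."  It is conventional to normalize the contribution of the
unit operator in the crossing equation to `1`: `(1 1 1) α(V⃗_{0⁺,0,0}) (1;1;1) = 1`.  If a functional exists
satisfying these conditions, then the hypothetical spectrum is ruled out."*

SOURCE, §3.2–§3.3.  *"There are four nonvanishing OPE coefficients involving just `s, φ, t` …
`λ_ext ≡ (λ_{sss}; λ_{φφs}; λ_{tts}; λ_{φφt})`.  We define the `4 × 4` symmetric matrices `V⃗_ext` as the bilinear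
forms paired with `λ_ext` in the crossing equations.  `V⃗_ext` is given implicitly by `λ_extᵀ V⃗_ext λ_ext =
(λ_{sss} λ_{φφs} λ_{tts}) V⃗_{0⁺,Δ_s,0} (λ_{sss}; λ_{φφs}; λ_{tts}) + (λ_{φφs} λ_{φφt}) V⃗_{1,Δ_φ,0} (λ_{φφs}; λ_{φφt})
+ (λ_{φφt} λ_{tts}) V⃗_{2,Δ_t,0} (λ_{φφt}; λ_{tts})`"* (footnote: *"OPE coefficients of scalar operators are
symmetric with respect to permutation"*); *"If we know nothing about `λ_ext`, then we can search for a
functional `α` such that `α(V⃗_ext) ⪰ 0` … However, (this) is stronger than necessary … suppose we know the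
equivalence class `[λ_ext] ∈ ℝP³` of `λ_ext` under rescaling by a real number … it suffices to impose the
weaker condition `λ_extᵀ α(V⃗_ext) λ_ext ≥ 0`"* (footnote: *"`λ_ext` can be any representative of the
equivalence class"*); *"The union of the resulting allowed regions must be contained inside the original
allowed region"*; §3.3: *"If `α` does not exist for some `[λ_ext]`, then the point `(Δ_s, Δ_φ, Δ_t)` is allowed.
If `α` exists for all `[λ_ext]`, then the point `(Δ_s, Δ_φ, Δ_t)` is disallowed."*

RENDERING.  `D : Dims` holds `(Δ_s, Δ_φ, Δ_t)`.  The fifteen printed superscripts `ij,kl` are the type `Label`;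
the blocks of ONE exchanged primary `(Δ, ℓ)` are an opaque family `g : Label → ℝ → ℝ → ℝ` (`g L` stands for
`g^{Δ_ij,Δ_kl}_{Δ,ℓ}` of that label — the source's identifications among them, e.g. that the six labels with
`Δ_ij = Δ_kl = 0` share one function, are NOT imposed and never needed), and `Fminus D g L`, `Fplus D g L` are
the printed `F^{ij,kl}_{∓}` with the printed exponent `(Δ_k+Δ_j)/2` (`Dims.expo`).  The sign `(−1)^ℓ` is an
explicit real parameter `ε` of `V1` and `V3`.  A functional is a real-linear map on `ℝ → ℝ → (Fin 22 → ℝ)`;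
`α(V⃗)` for a vector of matrices is the matrix of `α` applied entrywise (`alphaMat`).  The unit operator is
the `0⁺` member with all blocks `≡ 1` (`unitBlocks`) and couplings `(1, 1, 1)`.

WHAT IS PROVED.  (1) The quadratic forms `(λ…) V⃗ (λ…)ᵀ` of the four matrix vectors in closed form, row by
row (`quad0p_eq`, `quad0m_eq`, `quad1_eq`, `quad2p_eq`), the unit contribution (`quad0p_unit`), symmetry of
the printed matrices (`V0p_transpose`, …).  (2) CROSS-IDENTIFICATION WITH THE `{φ_i, s}` SYSTEM AT `N = 2`:
on the seven rows of the correlators of `φ` and `s` alone (rows 2, 1, 3, 13, 14, 18, 19, in the order of the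
seven KPSV equations) the four sectors `0⁺, 2⁺, 0⁻, 1` reproduce the KPSV vectors `V⃗_S`, `V⃗_T|_{N=2}`,
`V⃗_A`, `V⃗_V` of `ONMixedSumRule.lean` up to the row multipliers `(4, 2, −2, 2, 2, 2, 2)` and the sector
weights `1, ½, −1, ε` (`quad0p_kpsv`, `quad2p_kpsv`, `quad0m_kpsv`, `quad1_kpsv`) — the row multipliers and
the weights `1, ½` are the two papers' different normalisations of rows and couplings; the signs `−1` (sector
`0⁻`, whose spins are odd) and `ε = (−1)^ℓ` (sector `1`) are exactly the factor `(−1)^ℓ` that the 2020 block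
expansion carries explicitly and the 2015 one does not.  Since the KPSV rows ARE derived from crossing
symmetry there (`systemCrossingAt_iff`), this checks the transcription of those 28 entries against an
independent derivation, up to the stated conventions.  (3) `α` on quadratic forms: `x ⬝ (α(V⃗) x) = α(x ⬝ (V⃗ x))`
(`alphaMat_quadForm`), hence `α(V⃗) ⪰ 0 ⇒` every real coupling vector contributes `≥ 0`
(`quadVec_nonneg_of_posSemidef`), and `α(V⃗)` is symmetric (`isHermitian_alphaMat`, `posSemidef_alphaMat_iff`).
(4) `V⃗_ext` made EXPLICIT (`extForm`, `Vext`) with the defining identity of §3.2 PROVED (`quadVext_eq_parts`),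
homogeneity `quadVext_smul` (the condition sees only `[λ_ext] ∈ ℝP³`: `extWeak_smul_iff`), the strong
condition implies the weak one for every class (`extWeak_of_posSemidef`) and either one signs the external
term (`ext_nonneg_of_posSemidef`, `ext_nonneg_of_weak`), and the scan logic "disallowed iff excluded for
every class" including the degenerate `λ_ext = 0` (`false_of_forall_class`).  (5) The exclusion step:
`false_of_functional₂₂` (generic `α`; termwise application of `α` to the seven sector series as hypotheses,
positivity (3.1), normalisation `> 0`, external term `≥ 0`) and `false_of_pointFunctional₂₂` (finite
combinations of point evaluations, `pointFunctional₂₂`, for which termwise application is automatic,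
`hasSum_pointFunctional₂₂`; the crossing equation enters as "the grouped series vanish at every evaluation
point").

What is NOT here: the derivation of the 22 rows from crossing symmetry of the thirteen four-point functions
(the `O(2)` tensor structures of the source's appendix «Tensor structures», or `autoboot`,
Go–Tachikawa 2019, §4.2, which prints the same system) — the rows are QUOTED, and only their `{φ, s}` part is
checked against a derivation (item (2)); Table 1 of the source (row ↔ correlator) beyond what the labels say;
the spectrum assumptions of §2.2, the cutting-surface algorithm of §3.3–§3.4, `SDPB`, derivative functionals
and their termwise application (an analytic obligation left to the user, as in `ONMixedSumRule.lean`), and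
every number of §4.

## References
* S. M. Chester, W. Landry, J. Liu, D. Poland, D. Simmons-Duffin, N. Su, A. Vichi, *Carving out OPE space
  and precise O(2) model critical exponents*, JHEP 06 (2020) 142, arXiv:1912.03324, §2.1, §3.1–§3.3,
  appendix «Crossing vectors». [cite: ChesterEtAl2020]
* M. Go, Y. Tachikawa, *autoboot: a generator of bootstrap equations with global symmetry*, JHEP 06
  (2019) 084, arXiv:1903.10522, §4.2 (the same 22 equations, not transcribed here). [cite: GoTachikawa2019]
* F. Kos, D. Poland, D. Simmons-Duffin, A. Vichi, *Bootstrapping the O(N) archipelago*, JHEP 11 (2015)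
  106, §2.1–§2.2 (the `{φ_i, s}` system; `ONMixedSumRule.lean`). [cite: KosPolandSimmonsDuffinVichi2015]
-/

noncomputable section

open Finset Matrix
open Literature.MathematicalPhysics.QuantumFieldTheory.ONVectorSumRule
open Literature.MathematicalPhysics.QuantumFieldTheory.ONMixedSumRule

namespace Literature.MathematicalPhysics.QuantumFieldTheory.O2ThreeScalarCrossing

/-! ## 1. Labels, exponents and the symbols `F^{ij,kl}_∓` -/

/-- The fifteen superscripts `ij,kl` printed on the `F`-symbols of the seven crossing vectors (the four
external positions of the correlator the row comes from).  The block behind `F^{ij,kl}` is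
`g^{Δ_ij,Δ_kl}_{Δ,ℓ}`, `Δ_ij = Δ_i − Δ_j`: labels `φφφφ, tttt, ssss, ttφφ, ttss, φφss` have `(Δ_ij, Δ_kl) = (0,0)`;
`tφtφ ↦ (Δ_tφ, Δ_tφ)`, `φttφ ↦ (Δ_φt, Δ_tφ)`, `φsφs ↦ (Δ_φs, Δ_φs)`, `sφφs ↦ (Δ_sφ, Δ_φs)`, `φsφt ↦ (Δ_φs, Δ_φt)`,
`sφφt ↦ (Δ_sφ, Δ_φt)`, `tsts ↦ (Δ_ts, Δ_ts)`, `stts ↦ (Δ_st, Δ_ts)`, `φφst ↦ (0, Δ_st)`.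
[cite: ChesterEtAl2020, §2.1 (crossing equations, `F^{ij,kl}_{∓,Δ,ℓ}`)] -/
inductive Label
  | φφφφ | tttt | ssss | ttφφ | ttss | φφss
  | tφtφ | φttφ | φsφs | sφφs | φsφt | sφφt
  | tsts | stts | φφst

/-- The three external dimensions `(Δ_s, Δ_φ, Δ_t)`. [cite: ChesterEtAl2020, §2.1 (external scalars `s, φ, t`)] -/
structure Dims where
  /-- `Δ_s` (charge `0⁺`). -/
  Δs : ℝ
  /-- `Δ_φ` (charge `1`). -/
  Δφ : ℝ
  /-- `Δ_t` (charge `2`). -/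
  Δt : ℝ

/-- The printed exponent `(Δ_k + Δ_j)/2` of `F^{ij,kl}_∓`, label by label.
[cite: ChesterEtAl2020, §2.1 (`F^{ij,kl}_{∓,Δ,ℓ}`)] -/
def Dims.expo (D : Dims) : Label → ℝ
  | .φφφφ => D.Δφ
  | .tttt => D.Δt
  | .ssss => D.Δs
  | .ttφφ => (D.Δφ + D.Δt) / 2
  | .ttss => (D.Δs + D.Δt) / 2
  | .φφss => (D.Δφ + D.Δs) / 2
  | .tφtφ => (D.Δφ + D.Δt) / 2
  | .φttφ => D.Δt
  | .φsφs => (D.Δφ + D.Δs) / 2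
  | .sφφs => D.Δφ
  | .φsφt => (D.Δφ + D.Δs) / 2
  | .sφφt => D.Δφ
  | .tsts => (D.Δs + D.Δt) / 2
  | .stts => D.Δt
  | .φφst => (D.Δφ + D.Δs) / 2

/-- `F^{ij,kl}_{−}[g] (u,v) = v^{(Δ_k+Δ_j)/2} g_L(u,v) − u^{(Δ_k+Δ_j)/2} g_L(v,u)` for the label `L = ij,kl` of a block
family `g` (the imported `Fm` at the label's exponent). [cite: ChesterEtAl2020, §2.1 (`F^{ij,kl}_{∓,Δ,ℓ}`)] -/
def Fminus (D : Dims) (g : Label → ℝ → ℝ → ℝ) (L : Label) (u v : ℝ) : ℝ := Fm (D.expo L) (g L) u v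

/-- `F^{ij,kl}_{+}[g] (u,v) = v^{(Δ_k+Δ_j)/2} g_L(u,v) + u^{(Δ_k+Δ_j)/2} g_L(v,u)`.
[cite: ChesterEtAl2020, §2.1 (`F^{ij,kl}_{∓,Δ,ℓ}`)] -/
def Fplus (D : Dims) (g : Label → ℝ → ℝ → ℝ) (L : Label) (u v : ℝ) : ℝ := Fp (D.expo L) (g L) u v

/-! ## 2. The seven crossing vectors, verbatim (appendix «Crossing vectors») -/

/-- `V⃗_{0⁺,Δ,ℓ⁺}` — 22 symmetric `3 × 3` matrices, basis `(λ_{ss𝒪}, λ_{φφ𝒪}, λ_{tt𝒪})`, exchanged `0⁺` of even spin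
with block family `g`.  Rows: 1 `diag(0, 2F−^{φφ,φφ}, 0)`; 2 `0`; 3 `diag(0, −2F+^{φφ,φφ}, 0)`; 4 `diag(0,0,2F−^{tt,tt})`;
5 `0`; 6 `diag(0,0,−2F+^{tt,tt})`; 7, 8 `0`; 9, 10 `(2,3)=(3,2)=F−^{tt,φφ}`; 11, 12 `(2,3)=(3,2)=−F+^{tt,φφ}`;
13 `diag(2F−^{ss,ss},0,0)`; 14, 15 `0`; 16 `(1,3)=(3,1)=F−^{tt,ss}`; 17 `(1,3)=(3,1)=F+^{tt,ss}`;
18 `(1,2)=(2,1)=F−^{φφ,ss}`; 19 `(1,2)=(2,1)=F+^{φφ,ss}`; 20–22 `0`.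
[cite: ChesterEtAl2020, App. «Crossing vectors» (`V⃗_{0⁺,Δ,ℓ⁺}`)] -/
def V0p (D : Dims) (g : Label → ℝ → ℝ → ℝ) (u v : ℝ) : Fin 22 → Matrix (Fin 3) (Fin 3) ℝ :=
  ![!![0, 0, 0; 0, 2 * Fminus D g .φφφφ u v, 0; 0, 0, 0],
    0,
    !![0, 0, 0; 0, -2 * Fplus D g .φφφφ u v, 0; 0, 0, 0],
    !![0, 0, 0; 0, 0, 0; 0, 0, 2 * Fminus D g .tttt u v],
    0,
    !![0, 0, 0; 0, 0, 0; 0, 0, -2 * Fplus D g .tttt u v],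
    0,
    0,
    !![0, 0, 0; 0, 0, Fminus D g .ttφφ u v; 0, Fminus D g .ttφφ u v, 0],
    !![0, 0, 0; 0, 0, Fminus D g .ttφφ u v; 0, Fminus D g .ttφφ u v, 0],
    !![0, 0, 0; 0, 0, -Fplus D g .ttφφ u v; 0, -Fplus D g .ttφφ u v, 0],
    !![0, 0, 0; 0, 0, -Fplus D g .ttφφ u v; 0, -Fplus D g .ttφφ u v, 0],
    !![2 * Fminus D g .ssss u v, 0, 0; 0, 0, 0; 0, 0, 0],
    0,
    0,
    !![0, 0, Fminus D g .ttss u v; 0, 0, 0; Fminus D g .ttss u v, 0, 0],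
    !![0, 0, Fplus D g .ttss u v; 0, 0, 0; Fplus D g .ttss u v, 0, 0],
    !![0, Fminus D g .φφss u v, 0; Fminus D g .φφss u v, 0, 0; 0, 0, 0],
    !![0, Fplus D g .φφss u v, 0; Fplus D g .φφss u v, 0, 0; 0, 0, 0],
    0,
    0,
    0]

/-- `V⃗_{0⁻,Δ,ℓ⁻}` — 22 symmetric `2 × 2` matrices, basis `(λ_{φφ𝒪}, λ_{tt𝒪})`, exchanged `0⁻` of odd spin.
Rows: 1 `diag(2F−^{φφ,φφ},0)`; 2 `diag(−4F−^{φφ,φφ},0)`; 3 `diag(2F+^{φφ,φφ},0)`; 4 `diag(0,2F−^{tt,tt})`;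
5 `diag(0,−4F−^{tt,tt})`; 6 `diag(0,2F+^{tt,tt})`; 7, 8 `0`; 9 `offdiag(−F−^{tt,φφ})`; 10 `offdiag(F−^{tt,φφ})`;
11 `offdiag(F+^{tt,φφ})`; 12 `offdiag(−F+^{tt,φφ})`; 13–22 `0`.
[cite: ChesterEtAl2020, App. «Crossing vectors» (`V⃗_{0⁻,Δ,ℓ⁻}`)] -/
def V0m (D : Dims) (g : Label → ℝ → ℝ → ℝ) (u v : ℝ) : Fin 22 → Matrix (Fin 2) (Fin 2) ℝ :=
  ![!![2 * Fminus D g .φφφφ u v, 0; 0, 0],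
    !![-4 * Fminus D g .φφφφ u v, 0; 0, 0],
    !![2 * Fplus D g .φφφφ u v, 0; 0, 0],
    !![0, 0; 0, 2 * Fminus D g .tttt u v],
    !![0, 0; 0, -4 * Fminus D g .tttt u v],
    !![0, 0; 0, 2 * Fplus D g .tttt u v],
    0,
    0,
    !![0, -Fminus D g .ttφφ u v; -Fminus D g .ttφφ u v, 0],
    !![0, Fminus D g .ttφφ u v; Fminus D g .ttφφ u v, 0],
    !![0, Fplus D g .ttφφ u v; Fplus D g .ttφφ u v, 0],
    !![0, -Fplus D g .ttφφ u v; -Fplus D g .ttφφ u v, 0],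
    0, 0, 0, 0, 0, 0, 0, 0, 0, 0]

/-- `V⃗_{1,Δ,ℓ}` — 22 symmetric `2 × 2` matrices, basis `(λ_{φs𝒪}, λ_{tφ𝒪})`, exchanged charge-`1` operator of
spin `ℓ`, `ε = (−1)^ℓ`.  Rows: 1–6 `0`; 7 `diag(0, 2ε F−^{tφ,tφ})`; 8 `diag(0, 2ε F+^{tφ,tφ})`; 9 `0`;
10 `diag(0, 2F−^{φt,tφ})`; 11 `0`; 12 `diag(0, 2F+^{φt,tφ})`; 13 `0`; 14 `diag(2ε F−^{φs,φs}, 0)`; 15–17 `0`;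
18 `diag(2F−^{sφ,φs}, 0)`; 19 `diag(−2F+^{sφ,φs}, 0)`; 20 `offdiag(F−^{φs,φt})`; 21 `offdiag(ε F−^{sφ,φt})`;
22 `offdiag(ε F+^{sφ,φt})`. [cite: ChesterEtAl2020, App. «Crossing vectors» (`V⃗_{1,Δ,ℓ}`)] -/
def V1 (D : Dims) (ε : ℝ) (g : Label → ℝ → ℝ → ℝ) (u v : ℝ) : Fin 22 → Matrix (Fin 2) (Fin 2) ℝ :=
  ![0, 0, 0, 0, 0, 0,
    !![0, 0; 0, 2 * ε * Fminus D g .tφtφ u v],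
    !![0, 0; 0, 2 * ε * Fplus D g .tφtφ u v],
    0,
    !![0, 0; 0, 2 * Fminus D g .φttφ u v],
    0,
    !![0, 0; 0, 2 * Fplus D g .φttφ u v],
    0,
    !![2 * ε * Fminus D g .φsφs u v, 0; 0, 0],
    0, 0, 0,
    !![2 * Fminus D g .sφφs u v, 0; 0, 0],
    !![-2 * Fplus D g .sφφs u v, 0; 0, 0],
    !![0, Fminus D g .φsφt u v; Fminus D g .φsφt u v, 0],
    !![0, ε * Fminus D g .sφφt u v; ε * Fminus D g .sφφt u v, 0],
    !![0, ε * Fplus D g .sφφt u v; ε * Fplus D g .sφφt u v, 0]]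

/-- `V⃗_{2,Δ,ℓ⁺}` — 22 symmetric `2 × 2` matrices, basis `(λ_{φφ𝒪}, λ_{ts𝒪})`, exchanged charge-`2` operator of even
spin.  Rows: 1 `0`; 2 `diag(2F−^{φφ,φφ}, 0)`; 3 `diag(2F+^{φφ,φφ}, 0)` (printed `F_{+,Δ,Jℓ}`); 4–14 `0`;
15 `diag(0, 2F−^{ts,ts})`; 16 `diag(0, 2F−^{st,ts})`; 17 `diag(0, −2F+^{st,ts})`; 18–20 `0`; 21 `offdiag(F−^{φφ,st})`;
22 `offdiag(−F+^{φφ,st})`. [cite: ChesterEtAl2020, App. «Crossing vectors» (`V⃗_{2,Δ,ℓ⁺}`)] -/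
def V2p (D : Dims) (g : Label → ℝ → ℝ → ℝ) (u v : ℝ) : Fin 22 → Matrix (Fin 2) (Fin 2) ℝ :=
  ![0,
    !![2 * Fminus D g .φφφφ u v, 0; 0, 0],
    !![2 * Fplus D g .φφφφ u v, 0; 0, 0],
    0, 0, 0, 0, 0, 0, 0, 0, 0, 0, 0,
    !![0, 0; 0, 2 * Fminus D g .tsts u v],
    !![0, 0; 0, 2 * Fminus D g .stts u v],
    !![0, 0; 0, -2 * Fplus D g .stts u v],
    0, 0, 0,
    !![0, Fminus D g .φφst u v; Fminus D g .φφst u v, 0],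
    !![0, -Fplus D g .φφst u v; -Fplus D g .φφst u v, 0]]

/-- `V⃗_{2,Δ,ℓ⁻}` — 22 scalars, weight `λ²_{ts𝒪}`, exchanged charge-`2` operator of odd spin.  Rows: 1–14 `0`;
15 `−2F−^{ts,ts}`; 16 `2F−^{st,ts}`; 17 `−2F+^{st,ts}`; 18–22 `0`.
[cite: ChesterEtAl2020, App. «Crossing vectors» (`V⃗_{2,Δ,ℓ⁻}`)] -/
def V2m (D : Dims) (g : Label → ℝ → ℝ → ℝ) (u v : ℝ) : Fin 22 → ℝ :=
  ![0, 0, 0, 0, 0, 0, 0, 0, 0, 0, 0, 0, 0, 0,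
    -2 * Fminus D g .tsts u v, 2 * Fminus D g .stts u v, -2 * Fplus D g .stts u v,
    0, 0, 0, 0, 0]

/-- `V⃗_{3,Δ,ℓ}` — 22 scalars, weight `λ²_{tφ𝒪}`, exchanged charge-`3` operator of spin `ℓ`, `ε = (−1)^ℓ`.
Rows: 1–6 `0`; 7 `2ε F−^{tφ,tφ}`; 8 `−2ε F+^{tφ,tφ}`; 9 `2F−^{φt,tφ}`; 10 `0`; 11 `2F+^{φt,tφ}`; 12–22 `0`.
[cite: ChesterEtAl2020, App. «Crossing vectors» (`V⃗_{3,Δ,ℓ}`)] -/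
def V3 (D : Dims) (ε : ℝ) (g : Label → ℝ → ℝ → ℝ) (u v : ℝ) : Fin 22 → ℝ :=
  ![0, 0, 0, 0, 0, 0,
    2 * ε * Fminus D g .tφtφ u v, -2 * ε * Fplus D g .tφtφ u v, 2 * Fminus D g .φttφ u v, 0,
    2 * Fplus D g .φttφ u v,
    0, 0, 0, 0, 0, 0, 0, 0, 0, 0, 0]

/-- `V⃗_{4,Δ,ℓ⁺}` — 22 scalars, weight `λ²_{tt𝒪}`, exchanged charge-`4` operator of even spin.  Rows: 1–4 `0`;
5 `2F−^{tt,tt}`; 6 `2F+^{tt,tt}`; 7–22 `0`. [cite: ChesterEtAl2020, App. «Crossing vectors» (`V⃗_{4,Δ,ℓ⁺}`)] -/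
def V4 (D : Dims) (g : Label → ℝ → ℝ → ℝ) (u v : ℝ) : Fin 22 → ℝ :=
  ![0, 0, 0, 0, 2 * Fminus D g .tttt u v, 2 * Fplus D g .tttt u v,
    0, 0, 0, 0, 0, 0, 0, 0, 0, 0, 0, 0, 0, 0, 0, 0]

/-! ## 3. The quadratic forms `(λ…) V⃗ (λ…)ᵀ`, row by row -/

/-- The 22-component function `x ⬝ (V⃗[u,v]_r x)` of a vector of matrices and a real coupling vector `x` — the
summand of the crossing equation contributed by one exchanged operator.
[cite: ChesterEtAl2020, §2.1 (crossing equations)] -/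
def quadVec {n : ℕ} (x : Fin n → ℝ) (V : ℝ → ℝ → Fin 22 → Matrix (Fin n) (Fin n) ℝ) :
    ℝ → ℝ → Fin 22 → ℝ :=
  fun u v r => x ⬝ᵥ (V u v r *ᵥ x)

/-- The `0⁺` summand `(λ_{ss𝒪} λ_{φφ𝒪} λ_{tt𝒪}) V⃗_{0⁺}[g] (λ_{ss𝒪}; λ_{φφ𝒪}; λ_{tt𝒪})` with `(a, b, c) =
(λ_{ss𝒪}, λ_{φφ𝒪}, λ_{tt𝒪})`. [cite: ChesterEtAl2020, §2.1 (crossing equations, `0⁺` term)] -/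
def quad0p (D : Dims) (a b c : ℝ) (g : Label → ℝ → ℝ → ℝ) : ℝ → ℝ → Fin 22 → ℝ :=
  quadVec ![a, b, c] (V0p D g)

/-- The `0⁻` summand `(λ_{φφ𝒪} λ_{tt𝒪}) V⃗_{0⁻}[g] (λ_{φφ𝒪}; λ_{tt𝒪})`, `(b, c) = (λ_{φφ𝒪}, λ_{tt𝒪})`.
[cite: ChesterEtAl2020, §2.1 (crossing equations, `0⁻` term)] -/
def quad0m (D : Dims) (b c : ℝ) (g : Label → ℝ → ℝ → ℝ) : ℝ → ℝ → Fin 22 → ℝ :=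
  quadVec ![b, c] (V0m D g)

/-- The charge-`1` summand `(λ_{φs𝒪} λ_{tφ𝒪}) V⃗_{1}[ε; g] (λ_{φs𝒪}; λ_{tφ𝒪})`, `(x, y) = (λ_{φs𝒪}, λ_{tφ𝒪})`.
[cite: ChesterEtAl2020, §2.1 (crossing equations, charge-`1` term)] -/
def quad1 (D : Dims) (x y ε : ℝ) (g : Label → ℝ → ℝ → ℝ) : ℝ → ℝ → Fin 22 → ℝ :=
  quadVec ![x, y] (V1 D ε g)

/-- The charge-`2` even-spin summand `(λ_{φφ𝒪} λ_{ts𝒪}) V⃗_{2,ℓ⁺}[g] (λ_{φφ𝒪}; λ_{ts𝒪})`, `(b, z) = (λ_{φφ𝒪}, λ_{ts𝒪})`.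
[cite: ChesterEtAl2020, §2.1 (crossing equations, charge-`2` even term)] -/
def quad2p (D : Dims) (b z : ℝ) (g : Label → ℝ → ℝ → ℝ) : ℝ → ℝ → Fin 22 → ℝ :=
  quadVec ![b, z] (V2p D g)

/-- Closed form of the `0⁺` summand: `(2b²F−^{φφ,φφ}, 0, −2b²F+^{φφ,φφ}, 2c²F−^{tt,tt}, 0, −2c²F+^{tt,tt}, 0, 0,
2bcF−^{tt,φφ}, 2bcF−^{tt,φφ}, −2bcF+^{tt,φφ}, −2bcF+^{tt,φφ}, 2a²F−^{ss,ss}, 0, 0, 2acF−^{tt,ss}, 2acF+^{tt,ss},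
2abF−^{φφ,ss}, 2abF+^{φφ,ss}, 0, 0, 0)`. [cite: ChesterEtAl2020, App. «Crossing vectors» (`V⃗_{0⁺,Δ,ℓ⁺}`)] -/
theorem quad0p_eq (D : Dims) (a b c : ℝ) (g : Label → ℝ → ℝ → ℝ) (u v : ℝ) :
    quad0p D a b c g u v =
      ![2 * b ^ 2 * Fminus D g .φφφφ u v, 0, -(2 * b ^ 2 * Fplus D g .φφφφ u v),
        2 * c ^ 2 * Fminus D g .tttt u v, 0, -(2 * c ^ 2 * Fplus D g .tttt u v), 0, 0,
        2 * (b * c) * Fminus D g .ttφφ u v, 2 * (b * c) * Fminus D g .ttφφ u v,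
        -(2 * (b * c) * Fplus D g .ttφφ u v), -(2 * (b * c) * Fplus D g .ttφφ u v),
        2 * a ^ 2 * Fminus D g .ssss u v, 0, 0,
        2 * (a * c) * Fminus D g .ttss u v, 2 * (a * c) * Fplus D g .ttss u v,
        2 * (a * b) * Fminus D g .φφss u v, 2 * (a * b) * Fplus D g .φφss u v, 0, 0, 0] := by
  funext r
  fin_cases r <;> simp only [quad0p, quadVec, V0p, Matrix.cons_val_zero', Matrix.cons_val_succ'] <;>
    simp [Matrix.mulVec, dotProduct, Fin.sum_univ_three] <;> ring

/-- Closed form of the `0⁻` summand: `(2b²F−^{φφ,φφ}, −4b²F−^{φφ,φφ}, 2b²F+^{φφ,φφ}, 2c²F−^{tt,tt}, −4c²F−^{tt,tt},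
2c²F+^{tt,tt}, 0, 0, −2bcF−^{tt,φφ}, 2bcF−^{tt,φφ}, 2bcF+^{tt,φφ}, −2bcF+^{tt,φφ}, 0, …, 0)`.
[cite: ChesterEtAl2020, App. «Crossing vectors» (`V⃗_{0⁻,Δ,ℓ⁻}`)] -/
theorem quad0m_eq (D : Dims) (b c : ℝ) (g : Label → ℝ → ℝ → ℝ) (u v : ℝ) :
    quad0m D b c g u v =
      ![2 * b ^ 2 * Fminus D g .φφφφ u v, -(4 * b ^ 2 * Fminus D g .φφφφ u v),
        2 * b ^ 2 * Fplus D g .φφφφ u v, 2 * c ^ 2 * Fminus D g .tttt u v,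
        -(4 * c ^ 2 * Fminus D g .tttt u v), 2 * c ^ 2 * Fplus D g .tttt u v, 0, 0,
        -(2 * (b * c) * Fminus D g .ttφφ u v), 2 * (b * c) * Fminus D g .ttφφ u v,
        2 * (b * c) * Fplus D g .ttφφ u v, -(2 * (b * c) * Fplus D g .ttφφ u v),
        0, 0, 0, 0, 0, 0, 0, 0, 0, 0] := by
  funext r
  fin_cases r <;> simp only [quad0m, quadVec, V0m, Matrix.cons_val_zero', Matrix.cons_val_succ'] <;>
    simp [Matrix.mulVec, dotProduct, Fin.sum_univ_two] <;> ring

/-- Closed form of the charge-`1` summand: rows 7 `2εy²F−^{tφ,tφ}`, 8 `2εy²F+^{tφ,tφ}`, 10 `2y²F−^{φt,tφ}`,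
12 `2y²F+^{φt,tφ}`, 14 `2εx²F−^{φs,φs}`, 18 `2x²F−^{sφ,φs}`, 19 `−2x²F+^{sφ,φs}`, 20 `2xyF−^{φs,φt}`, 21 `2εxyF−^{sφ,φt}`,
22 `2εxyF+^{sφ,φt}`, all other rows `0`. [cite: ChesterEtAl2020, App. «Crossing vectors» (`V⃗_{1,Δ,ℓ}`)] -/
theorem quad1_eq (D : Dims) (x y ε : ℝ) (g : Label → ℝ → ℝ → ℝ) (u v : ℝ) :
    quad1 D x y ε g u v =
      ![0, 0, 0, 0, 0, 0, 2 * ε * y ^ 2 * Fminus D g .tφtφ u v, 2 * ε * y ^ 2 * Fplus D g .tφtφ u v, 0,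
        2 * y ^ 2 * Fminus D g .φttφ u v, 0, 2 * y ^ 2 * Fplus D g .φttφ u v, 0,
        2 * ε * x ^ 2 * Fminus D g .φsφs u v, 0, 0, 0,
        2 * x ^ 2 * Fminus D g .sφφs u v, -(2 * x ^ 2 * Fplus D g .sφφs u v),
        2 * (x * y) * Fminus D g .φsφt u v, 2 * ε * (x * y) * Fminus D g .sφφt u v,
        2 * ε * (x * y) * Fplus D g .sφφt u v] := by
  funext r
  fin_cases r <;> simp only [quad1, quadVec, V1, Matrix.cons_val_zero', Matrix.cons_val_succ'] <;>
    simp [Matrix.mulVec, dotProduct, Fin.sum_univ_two] <;> ring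

/-- Closed form of the charge-`2` even summand: rows 2 `2b²F−^{φφ,φφ}`, 3 `2b²F+^{φφ,φφ}`, 15 `2z²F−^{ts,ts}`,
16 `2z²F−^{st,ts}`, 17 `−2z²F+^{st,ts}`, 21 `2bzF−^{φφ,st}`, 22 `−2bzF+^{φφ,st}`, all other rows `0`.
[cite: ChesterEtAl2020, App. «Crossing vectors» (`V⃗_{2,Δ,ℓ⁺}`)] -/
theorem quad2p_eq (D : Dims) (b z : ℝ) (g : Label → ℝ → ℝ → ℝ) (u v : ℝ) :
    quad2p D b z g u v =
      ![0, 2 * b ^ 2 * Fminus D g .φφφφ u v, 2 * b ^ 2 * Fplus D g .φφφφ u v,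
        0, 0, 0, 0, 0, 0, 0, 0, 0, 0, 0,
        2 * z ^ 2 * Fminus D g .tsts u v, 2 * z ^ 2 * Fminus D g .stts u v,
        -(2 * z ^ 2 * Fplus D g .stts u v), 0, 0, 0,
        2 * (b * z) * Fminus D g .φφst u v, -(2 * (b * z) * Fplus D g .φφst u v)] := by
  funext r
  fin_cases r <;> simp only [quad2p, quadVec, V2p, Matrix.cons_val_zero', Matrix.cons_val_succ'] <;>
    simp [Matrix.mulVec, dotProduct, Fin.sum_univ_two] <;> ring

/-- A `3 × 3` literal with mirrored off-diagonal entries is symmetric (the shape of every printed matrix row).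
[cite: ChesterEtAl2020, App. «Crossing vectors» (symmetric matrices)] -/
theorem transpose_symm₃ (a b c d e f : ℝ) :
    (!![a, b, c; b, d, e; c, e, f] : Matrix (Fin 3) (Fin 3) ℝ)ᵀ = !![a, b, c; b, d, e; c, e, f] := by
  ext i j
  fin_cases i <;> fin_cases j <;> rfl

/-- A `2 × 2` literal with mirrored off-diagonal entries is symmetric.
[cite: ChesterEtAl2020, App. «Crossing vectors» (symmetric matrices)] -/
theorem transpose_symm₂ (a b d : ℝ) : (!![a, b; b, d] : Matrix (Fin 2) (Fin 2) ℝ)ᵀ = !![a, b; b, d] := by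
  ext i j
  fin_cases i <;> fin_cases j <;> rfl

/-- The printed `V⃗_{0⁺}` matrices are symmetric. [cite: ChesterEtAl2020, App. «Crossing vectors» (`V⃗_{0⁺,Δ,ℓ⁺}`)] -/
theorem V0p_transpose (D : Dims) (g : Label → ℝ → ℝ → ℝ) (u v : ℝ) (r : Fin 22) :
    (V0p D g u v r)ᵀ = V0p D g u v r := by
  fin_cases r <;> first | exact Matrix.transpose_zero | exact transpose_symm₃ ..

/-- The printed `V⃗_{0⁻}` matrices are symmetric. [cite: ChesterEtAl2020, App. «Crossing vectors» (`V⃗_{0⁻,Δ,ℓ⁻}`)] -/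
theorem V0m_transpose (D : Dims) (g : Label → ℝ → ℝ → ℝ) (u v : ℝ) (r : Fin 22) :
    (V0m D g u v r)ᵀ = V0m D g u v r := by
  fin_cases r <;> first | exact Matrix.transpose_zero | exact transpose_symm₂ ..

/-- The printed `V⃗_{1}` matrices are symmetric. [cite: ChesterEtAl2020, App. «Crossing vectors» (`V⃗_{1,Δ,ℓ}`)] -/
theorem V1_transpose (D : Dims) (ε : ℝ) (g : Label → ℝ → ℝ → ℝ) (u v : ℝ) (r : Fin 22) :
    (V1 D ε g u v r)ᵀ = V1 D ε g u v r := by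
  fin_cases r <;> first | exact Matrix.transpose_zero | exact transpose_symm₂ ..

/-- The printed `V⃗_{2,ℓ⁺}` matrices are symmetric. [cite: ChesterEtAl2020, App. «Crossing vectors» (`V⃗_{2,Δ,ℓ⁺}`)] -/
theorem V2p_transpose (D : Dims) (g : Label → ℝ → ℝ → ℝ) (u v : ℝ) (r : Fin 22) :
    (V2p D g u v r)ᵀ = V2p D g u v r := by
  fin_cases r <;> first | exact Matrix.transpose_zero | exact transpose_symm₂ ..

/-- The blocks of the unit operator: `g_{0,0} ≡ 1` for every label (only the six labels with `Δ_ij = Δ_kl = 0`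
enter `V⃗_{0⁺}`, the one vector the unit contributes to, with couplings `λ_{ss1} = λ_{φφ1} = λ_{tt1} = 1`).
[cite: ChesterEtAl2020, §3.1 (unit operator, `V⃗_{0⁺,0,0}`)] -/
def unitBlocks : Label → ℝ → ℝ → ℝ := fun _ _ _ => 1

/-- The unit contribution `(1 1 1) V⃗_{0⁺,0,0} (1;1;1)`: `(2(v^{Δφ} − u^{Δφ}), 0, −2(v^{Δφ} + u^{Δφ}), 2(v^{Δt} − u^{Δt}), 0,
−2(v^{Δt} + u^{Δt}), 0, 0, 2(v^{p} − u^{p}), 2(v^{p} − u^{p}), −2(v^{p} + u^{p}), −2(v^{p} + u^{p}), 2(v^{Δs} − u^{Δs}), 0,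
0, 2(v^{q} − u^{q}), 2(v^{q} + u^{q}), 2(v^{w} − u^{w}), 2(v^{w} + u^{w}), 0, 0, 0)` with `p = (Δφ+Δt)/2`,
`q = (Δs+Δt)/2`, `w = (Δφ+Δs)/2`. [cite: ChesterEtAl2020, §3.1 (unit operator, `V⃗_{0⁺,0,0}`)] -/
theorem quad0p_unit (D : Dims) (u v : ℝ) :
    quad0p D 1 1 1 unitBlocks u v =
      ![2 * (v ^ D.Δφ - u ^ D.Δφ), 0, -(2 * (v ^ D.Δφ + u ^ D.Δφ)),
        2 * (v ^ D.Δt - u ^ D.Δt), 0, -(2 * (v ^ D.Δt + u ^ D.Δt)), 0, 0,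
        2 * (v ^ ((D.Δφ + D.Δt) / 2) - u ^ ((D.Δφ + D.Δt) / 2)),
        2 * (v ^ ((D.Δφ + D.Δt) / 2) - u ^ ((D.Δφ + D.Δt) / 2)),
        -(2 * (v ^ ((D.Δφ + D.Δt) / 2) + u ^ ((D.Δφ + D.Δt) / 2))),
        -(2 * (v ^ ((D.Δφ + D.Δt) / 2) + u ^ ((D.Δφ + D.Δt) / 2))),
        2 * (v ^ D.Δs - u ^ D.Δs), 0, 0,
        2 * (v ^ ((D.Δs + D.Δt) / 2) - u ^ ((D.Δs + D.Δt) / 2)),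
        2 * (v ^ ((D.Δs + D.Δt) / 2) + u ^ ((D.Δs + D.Δt) / 2)),
        2 * (v ^ ((D.Δφ + D.Δs) / 2) - u ^ ((D.Δφ + D.Δs) / 2)),
        2 * (v ^ ((D.Δφ + D.Δs) / 2) + u ^ ((D.Δφ + D.Δs) / 2)), 0, 0, 0] := by
  rw [quad0p_eq]
  funext r
  fin_cases r <;> simp only [Matrix.cons_val_zero', Matrix.cons_val_succ'] <;>
    simp [Fminus, Fplus, Fm, Fp, unitBlocks, Dims.expo]

/-! ## 4. Cross-identification of the `{φ, s}` rows with the KPSV `{φ_i, s}` system at `N = 2`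

*"The singlet `S`, traceless symmetric `T`, vector `V` and antisymmetric `A` irreps considered in previous
`O(N)` bootstrap papers correspond for `O(2)` to the `0⁺`, `2`, `1`, and `0⁻` irreps"* (§2.1).  The seven KPSV
equations (`ONMixedSumRule.lean`, rows `0–6`: three of `⟨φφφφ⟩`, then `⟨ssss⟩`, `⟨φsφs⟩`, `⟨φφss⟩_∓`) sit in
the present rows `2, 1, 3, 13, 14, 18, 19`; on them the couplings `λ_{tt𝒪}`, `λ_{tφ𝒪}`, `λ_{ts𝒪}` and the sectors
`2⁻, 3, 4` do not enter, and the four remaining sectors reproduce the KPSV vectors with the row multipliers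
`kpsvMul = (4, 2, −2, 2, 2, 2, 2)` and the sector weights `0⁺ ↦ 1·V⃗_S`, `2⁺ ↦ ½·V⃗_T|_{N=2}`, `0⁻ ↦ −V⃗_A`,
`1 ↦ ε·V⃗_V` (the signs are the explicit `(−1)^ℓ` of the 2020 expansion: `0⁻` operators have odd spin, and
`ε² = 1` is used on the rows of `⟨sφφs⟩`).  Only the algebraic identities are asserted; which convention of
which paper they reflect is commentary. -/

/-- The positions (0-based) of the seven KPSV rows among the 22 rows: `(2, 1, 3, 13, 14, 18, 19)` (1-based).
[cite: ChesterEtAl2020, §2.1 (dictionary `S, T, V, A ↔ 0⁺, 2, 1, 0⁻`)] -/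
def kpsvRow : Fin 7 → Fin 22 := ![1, 0, 2, 12, 13, 17, 18]

/-- The row multipliers `(4, 2, −2, 2, 2, 2, 2)` of the cross-identification.
[cite: ChesterEtAl2020, §2.1 (dictionary `S, T, V, A ↔ 0⁺, 2, 1, 0⁻`)] -/
def kpsvMul : Fin 7 → ℝ := ![4, 2, -2, 2, 2, 2, 2]

/-- `0⁺ ↔ S`: on the seven `{φ, s}` rows the `0⁺` summand is `kpsvMul ·` the KPSV singlet summand
`(λ_{φφ𝒪} λ_{ss𝒪}) V⃗_S[g₀] (λ_{φφ𝒪}; λ_{ss𝒪})` (`quadVS`, exponents `Δφ, Δs, (Δφ+Δs)/2`), for a block family whose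
`φφφφ`, `ssss`, `φφss` members are `g₀`. [cite: ChesterEtAl2020, §2.1 (dictionary `S ↔ 0⁺`)]
[cite: KosPolandSimmonsDuffinVichi2015, §2.1 (`V⃗_S`)] -/
theorem quad0p_kpsv (D : Dims) (a b c : ℝ) {g : Label → ℝ → ℝ → ℝ} {g₀ : ℝ → ℝ → ℝ}
    (h₁ : g .φφφφ = g₀) (h₂ : g .ssss = g₀) (h₃ : g .φφss = g₀) (u v : ℝ) (k : Fin 7) :
    quad0p D a b c g u v (kpsvRow k) = kpsvMul k * quadVS D.Δφ D.Δs b a g₀ u v k := by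
  rw [quad0p_eq, quadVS_eq]
  fin_cases k <;> simp only [kpsvRow, kpsvMul, Matrix.cons_val_zero', Matrix.cons_val_succ', Matrix.cons_val] <;>
    simp [Fminus, Fplus, Dims.expo, h₁, h₂, h₃] <;> ring

/-- `2⁺ ↔ T`: on the seven `{φ, s}` rows the charge-`2` even summand is `kpsvMul · ½ ·` the KPSV summand
`λ²_{φφ𝒪} V⃗_T|_{N=2}[g₀]` (whose second entry `(1 − 2/N) F−` vanishes at `N = 2`).
[cite: ChesterEtAl2020, §2.1 (dictionary `T ↔ 2`)] [cite: KosPolandSimmonsDuffinVichi2015, §2.1 (`V⃗_T`)] -/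
theorem quad2p_kpsv (D : Dims) (b z : ℝ) {g : Label → ℝ → ℝ → ℝ} {g₀ : ℝ → ℝ → ℝ} (h₁ : g .φφφφ = g₀)
    (u v : ℝ) (k : Fin 7) :
    quad2p D b z g u v (kpsvRow k) = kpsvMul k * (1 / 2) * (b ^ 2 * V7T 2 D.Δφ g₀ u v k) := by
  rw [quad2p_eq]
  fin_cases k <;> simp only [kpsvRow, kpsvMul, Matrix.cons_val_zero', Matrix.cons_val_succ', Matrix.cons_val] <;>
    simp [V7T, Fminus, Fplus, Dims.expo, h₁] <;> ring

/-- `0⁻ ↔ A`: on the seven `{φ, s}` rows the `0⁻` summand is `kpsvMul · (−1) ·` the KPSV summand `λ²_{φφ𝒪} V⃗_A[g₀]`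
(sign: the 2015 `V⃗_A` versus the 2020 `(−1)^ℓ`-weighted expansion; `0⁻` spins are odd).
[cite: ChesterEtAl2020, §2.1 (dictionary `A ↔ 0⁻`)] [cite: KosPolandSimmonsDuffinVichi2015, §2.1 (`V⃗_A`)] -/
theorem quad0m_kpsv (D : Dims) (b c : ℝ) {g : Label → ℝ → ℝ → ℝ} {g₀ : ℝ → ℝ → ℝ} (h₁ : g .φφφφ = g₀)
    (u v : ℝ) (k : Fin 7) :
    quad0m D b c g u v (kpsvRow k) = kpsvMul k * (-(b ^ 2 * V7A D.Δφ g₀ u v k)) := by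
  rw [quad0m_eq]
  fin_cases k <;> simp only [kpsvRow, kpsvMul, Matrix.cons_val_zero', Matrix.cons_val_succ', Matrix.cons_val] <;>
    simp [V7A, Fminus, Fplus, Dims.expo, h₁] <;> ring

/-- `1 ↔ V`: on the seven `{φ, s}` rows the charge-`1` summand with sign `ε = ±1` is `kpsvMul · ε ·` the KPSV
summand `λ²_{φs𝒪} V⃗_V[ε; g₁, g₂]` with `g₁ = g^{φs,φs}`, `g₂ = g^{sφ,φs}`.
[cite: ChesterEtAl2020, §2.1 (dictionary `V ↔ 1`)] [cite: KosPolandSimmonsDuffinVichi2015, §2.1 (`V⃗_V`)] -/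
theorem quad1_kpsv (D : Dims) (x y : ℝ) {ε : ℝ} (hε : ε = 1 ∨ ε = -1) (g : Label → ℝ → ℝ → ℝ)
    (u v : ℝ) (k : Fin 7) :
    quad1 D x y ε g u v (kpsvRow k) =
      kpsvMul k * (ε * (x ^ 2 * V7V D.Δφ D.Δs ε (g .φsφs) (g .sφφs) u v k)) := by
  rw [quad1_eq]
  rcases hε with rfl | rfl <;> fin_cases k <;>
    simp only [kpsvRow, kpsvMul, Matrix.cons_val_zero', Matrix.cons_val_succ', Matrix.cons_val] <;>
    simp [V7V, Fminus, Fplus, Dims.expo] <;> ring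

/-! ## 5. `α` on vectors of matrices -/

/-- `α(V⃗)` for a vector of `n × n` matrices: the matrix of `α` applied entry by entry (the source's
`α(V⃗_{0⁺,Δ,ℓ⁺}) ⪰ 0` etc. are statements about this matrix). [cite: ChesterEtAl2020, §3.1 (functional conditions)] -/
def alphaMat {n : ℕ} (α : (ℝ → ℝ → Fin 22 → ℝ) →ₗ[ℝ] ℝ)
    (V : ℝ → ℝ → Fin 22 → Matrix (Fin n) (Fin n) ℝ) : Matrix (Fin n) (Fin n) ℝ :=
  Matrix.of fun i j => α (fun u v r => V u v r i j)

/-- Entries of `α(V⃗)`. [cite: ChesterEtAl2020, §3.1 (functional conditions)] -/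
theorem alphaMat_apply {n : ℕ} (α : (ℝ → ℝ → Fin 22 → ℝ) →ₗ[ℝ] ℝ)
    (V : ℝ → ℝ → Fin 22 → Matrix (Fin n) (Fin n) ℝ) (i j : Fin n) :
    alphaMat α V i j = α (fun u v r => V u v r i j) := rfl

/-- The summand as a combination of entry functions: `x ⬝ (V⃗ x) = Σ_{i,j} x_i x_j · V⃗_{ij}`.
[cite: ChesterEtAl2020, §2.1 (crossing equations)] -/
theorem quadVec_eq_sum {n : ℕ} (x : Fin n → ℝ) (V : ℝ → ℝ → Fin 22 → Matrix (Fin n) (Fin n) ℝ) :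
    quadVec x V = ∑ i, ∑ j, (x i * x j) • (fun u v r => V u v r i j) := by
  funext u v r
  simp only [quadVec, dotProduct, Matrix.mulVec, Finset.sum_apply, Pi.smul_apply, smul_eq_mul,
    Finset.mul_sum]
  refine Finset.sum_congr rfl fun i _ => Finset.sum_congr rfl fun j _ => ?_
  ring

/-- **Linearity moves `α` inside the quadratic form**: `x ⬝ (α(V⃗) x) = α(x ⬝ (V⃗ x))`.
[cite: ChesterEtAl2020, §3.2 ("`λ_extᵀ α(V⃗_ext) λ_ext` is a number")] -/
theorem alphaMat_quadForm {n : ℕ} (α : (ℝ → ℝ → Fin 22 → ℝ) →ₗ[ℝ] ℝ)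
    (V : ℝ → ℝ → Fin 22 → Matrix (Fin n) (Fin n) ℝ) (x : Fin n → ℝ) :
    x ⬝ᵥ (alphaMat α V *ᵥ x) = α (quadVec x V) := by
  rw [quadVec_eq_sum, map_sum]
  simp only [map_sum, map_smul, smul_eq_mul, dotProduct, Matrix.mulVec, alphaMat, Matrix.of_apply,
    Finset.mul_sum]
  refine Finset.sum_congr rfl fun i _ => Finset.sum_congr rfl fun j _ => ?_
  ring

/-- **What `⪰ 0` buys**: if `α(V⃗) ⪰ 0` then the applied summand `α(x ⬝ (V⃗ x))` is `≥ 0` for EVERY real coupling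
vector `x`, whatever the signs and sizes of the couplings. [cite: ChesterEtAl2020, §3.1 ("`M ⪰ 0`")] -/
theorem quadVec_nonneg_of_posSemidef {n : ℕ} (α : (ℝ → ℝ → Fin 22 → ℝ) →ₗ[ℝ] ℝ)
    {V : ℝ → ℝ → Fin 22 → Matrix (Fin n) (Fin n) ℝ} (h : (alphaMat α V).PosSemidef) (x : Fin n → ℝ) :
    0 ≤ α (quadVec x V) := by
  have := h.dotProduct_mulVec_nonneg x
  rwa [star_trivial, alphaMat_quadForm] at this

/-- `α(V⃗)` of a vector of symmetric matrices is symmetric. [cite: ChesterEtAl2020, §3.1 ("`M ⪰ 0`")] -/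
theorem isHermitian_alphaMat {n : ℕ} (α : (ℝ → ℝ → Fin 22 → ℝ) →ₗ[ℝ] ℝ)
    {V : ℝ → ℝ → Fin 22 → Matrix (Fin n) (Fin n) ℝ} (hV : ∀ u v r, (V u v r)ᵀ = V u v r) :
    (alphaMat α V).IsHermitian := by
  unfold Matrix.IsHermitian
  ext i j
  simp only [conjTranspose_apply, star_trivial, alphaMat_apply]
  congr 1
  funext u v r
  rw [← hV u v r, transpose_apply, hV]

/-- For a vector of symmetric matrices, `α(V⃗) ⪰ 0` IS the statement "`α(x ⬝ (V⃗ x)) ≥ 0` for every real `x`".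
[cite: ChesterEtAl2020, §3.1 ("`M ⪰ 0`")] -/
theorem posSemidef_alphaMat_iff {n : ℕ} (α : (ℝ → ℝ → Fin 22 → ℝ) →ₗ[ℝ] ℝ)
    {V : ℝ → ℝ → Fin 22 → Matrix (Fin n) (Fin n) ℝ} (hV : ∀ u v r, (V u v r)ᵀ = V u v r) :
    (alphaMat α V).PosSemidef ↔ ∀ x : Fin n → ℝ, 0 ≤ α (quadVec x V) := by
  refine ⟨fun h x => quadVec_nonneg_of_posSemidef α h x, fun h => ?_⟩
  refine PosSemidef.of_dotProduct_mulVec_nonneg (isHermitian_alphaMat α hV) fun x => ?_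
  rw [star_trivial, alphaMat_quadForm]
  exact h x

/-- `(a b c) α(V⃗_{0⁺}[g]) (a;b;c) = α` of the `0⁺` summand. [cite: ChesterEtAl2020, §3.1 (`α(V⃗_{0⁺,Δ,ℓ⁺}) ⪰ 0`)] -/
theorem alpha_quad0p (α : (ℝ → ℝ → Fin 22 → ℝ) →ₗ[ℝ] ℝ) (D : Dims) (a b c : ℝ)
    (g : Label → ℝ → ℝ → ℝ) :
    ![a, b, c] ⬝ᵥ (alphaMat α (V0p D g) *ᵥ ![a, b, c]) = α (quad0p D a b c g) :=
  alphaMat_quadForm α (V0p D g) ![a, b, c]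

/-! ## 6. The external scalars: `λ_ext`, `V⃗_ext` explicit, the strong and the weak condition, the scan -/

/-- The `4 × 4` form assembled from a `3 × 3` block on the coordinates `(0, 1, 2)`, a `2 × 2` block on `(1, 3)`
and a `2 × 2` block on `(3, 2)` of `λ_ext = (λ_{sss}, λ_{φφs}, λ_{tts}, λ_{φφt})` — the index bookkeeping of the
defining identity of `V⃗_ext`. [cite: ChesterEtAl2020, §3.2 (`V⃗_ext` defined implicitly)] -/
def extForm (M : Matrix (Fin 3) (Fin 3) ℝ) (P Q : Matrix (Fin 2) (Fin 2) ℝ) : Matrix (Fin 4) (Fin 4) ℝ :=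
  !![M 0 0, M 0 1, M 0 2, 0;
     M 1 0, M 1 1 + P 0 0, M 1 2, P 0 1;
     M 2 0, M 2 1, M 2 2 + Q 1 1, Q 1 0;
     0, P 1 0, Q 0 1, P 1 1 + Q 0 0]

/-- The bookkeeping identity: `l ⬝ (extForm M P Q) l = (l₀ l₁ l₂) M (l₀;l₁;l₂) + (l₁ l₃) P (l₁;l₃) + (l₃ l₂) Q (l₃;l₂)`.
[cite: ChesterEtAl2020, §3.2 (`V⃗_ext` defined implicitly)] -/
theorem extForm_quad (M : Matrix (Fin 3) (Fin 3) ℝ) (P Q : Matrix (Fin 2) (Fin 2) ℝ) (l : Fin 4 → ℝ) :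
    l ⬝ᵥ (extForm M P Q *ᵥ l) =
      ![l 0, l 1, l 2] ⬝ᵥ (M *ᵥ ![l 0, l 1, l 2]) + ![l 1, l 3] ⬝ᵥ (P *ᵥ ![l 1, l 3]) +
        ![l 3, l 2] ⬝ᵥ (Q *ᵥ ![l 3, l 2]) := by
  simp [extForm, Matrix.mulVec, dotProduct, Fin.sum_univ_four, Fin.sum_univ_three, Fin.sum_univ_two]
  ring

/-- `extForm` of symmetric blocks is symmetric. [cite: ChesterEtAl2020, §3.2 ("`4 × 4` symmetric matrices `V⃗_ext`")] -/
theorem extForm_transpose {M : Matrix (Fin 3) (Fin 3) ℝ} {P Q : Matrix (Fin 2) (Fin 2) ℝ} (hM : Mᵀ = M)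
    (hP : Pᵀ = P) (hQ : Qᵀ = Q) : (extForm M P Q)ᵀ = extForm M P Q := by
  have hM' : ∀ i j, M j i = M i j := fun i j => by rw [← hM, transpose_apply, hM]
  have hP' : ∀ i j, P j i = P i j := fun i j => by rw [← hP, transpose_apply, hP]
  have hQ' : ∀ i j, Q j i = Q i j := fun i j => by rw [← hQ, transpose_apply, hQ]
  ext i j
  fin_cases i <;> fin_cases j <;> simp [extForm, hM', hP', hQ']

/-- **`V⃗_ext`, explicit**: row by row, `extForm` of `V⃗_{0⁺,Δ_s,0}[gs]` (the exchanged `s`, blocks `gs`),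
`V⃗_{1,Δ_φ,0}[ε = 1; gφ]` (the exchanged `φ`, spin `0`) and `V⃗_{2,Δ_t,0}[gt]` (the exchanged `t`).
[cite: ChesterEtAl2020, §3.2 (`V⃗_ext` defined implicitly)] -/
def Vext (D : Dims) (gs gφ gt : Label → ℝ → ℝ → ℝ) (u v : ℝ) (r : Fin 22) : Matrix (Fin 4) (Fin 4) ℝ :=
  extForm (V0p D gs u v r) (V1 D 1 gφ u v r) (V2p D gt u v r)

/-- `V⃗_ext` is symmetric. [cite: ChesterEtAl2020, §3.2 ("`4 × 4` symmetric matrices `V⃗_ext`")] -/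
theorem Vext_transpose (D : Dims) (gs gφ gt : Label → ℝ → ℝ → ℝ) (u v : ℝ) (r : Fin 22) :
    (Vext D gs gφ gt u v r)ᵀ = Vext D gs gφ gt u v r :=
  extForm_transpose (V0p_transpose D gs u v r) (V1_transpose D 1 gφ u v r) (V2p_transpose D gt u v r)

/-- The external-scalar term `λ_extᵀ V⃗_ext λ_ext` for `l = λ_ext = (λ_{sss}, λ_{φφs}, λ_{tts}, λ_{φφt})`.
[cite: ChesterEtAl2020, §3.2 (`λ_ext`, `V⃗_ext`)] -/
def quadVext (D : Dims) (l : Fin 4 → ℝ) (gs gφ gt : Label → ℝ → ℝ → ℝ) : ℝ → ℝ → Fin 22 → ℝ :=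
  quadVec l (Vext D gs gφ gt)

/-- **The defining identity of `V⃗_ext`, proved**: `λ_extᵀ V⃗_ext λ_ext = (λ_{sss} λ_{φφs} λ_{tts}) V⃗_{0⁺,Δ_s,0}
(λ_{sss};λ_{φφs};λ_{tts}) + (λ_{φφs} λ_{φφt}) V⃗_{1,Δ_φ,0} (λ_{φφs};λ_{φφt}) + (λ_{φφt} λ_{tts}) V⃗_{2,Δ_t,0} (λ_{φφt};λ_{tts})`
— the three summands of the crossing equation for the exchanged `s` (in `0⁺`, couplings `(λ_{sss}, λ_{φφs}, λ_{tts})`),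
`φ` (in charge `1`, couplings `(λ_{φsφ}, λ_{tφφ}) = (λ_{φφs}, λ_{φφt})` by permutation symmetry) and `t` (in `2⁺`,
couplings `(λ_{φφt}, λ_{tst}) = (λ_{φφt}, λ_{tts})`). [cite: ChesterEtAl2020, §3.2 (`V⃗_ext` defined implicitly)] -/
theorem quadVext_eq_parts (D : Dims) (l : Fin 4 → ℝ) (gs gφ gt : Label → ℝ → ℝ → ℝ) :
    quadVext D l gs gφ gt =
      quad0p D (l 0) (l 1) (l 2) gs + quad1 D (l 1) (l 3) 1 gφ + quad2p D (l 3) (l 2) gt := by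
  funext u v r
  exact extForm_quad _ _ _ l

/-- Homogeneity: rescaling `λ_ext ↦ c λ_ext` rescales the external term by `c²` — the conditions below see only
the class `[λ_ext] ∈ ℝP³`. [cite: ChesterEtAl2020, §3.2 (equivalence class `[λ_ext] ∈ ℝP³`)] -/
theorem quadVext_smul (D : Dims) (c : ℝ) (l : Fin 4 → ℝ) (gs gφ gt : Label → ℝ → ℝ → ℝ) :
    quadVext D (c • l) gs gφ gt = c ^ 2 • quadVext D l gs gφ gt := by
  funext u v r
  simp only [quadVext, quadVec, Pi.smul_apply, smul_eq_mul, Matrix.mulVec_smul, dotProduct_smul,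
    smul_dotProduct]
  ring

/-- **The strong condition `α(V⃗_ext) ⪰ 0`** ("if we know nothing about `λ_ext`") signs the external term for EVERY
`λ_ext`. [cite: ChesterEtAl2020, §3.2 (strong condition `α(V⃗_ext) ⪰ 0`)] -/
theorem ext_nonneg_of_posSemidef (α : (ℝ → ℝ → Fin 22 → ℝ) →ₗ[ℝ] ℝ) {D : Dims}
    {gs gφ gt : Label → ℝ → ℝ → ℝ} (h : (alphaMat α (Vext D gs gφ gt)).PosSemidef) (l : Fin 4 → ℝ) :
    0 ≤ α (quadVext D l gs gφ gt) :=
  quadVec_nonneg_of_posSemidef α h l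

/-- **The weaker condition `λ_extᵀ α(V⃗_ext) λ_ext ≥ 0`** at a representative `l` of the class: it signs the external
term of every `λ_ext = c l` of that class ("independent of the magnitude or sign of `λ_ext`").
[cite: ChesterEtAl2020, §3.2 (weaker condition)] -/
theorem ext_nonneg_of_weak (α : (ℝ → ℝ → Fin 22 → ℝ) →ₗ[ℝ] ℝ) {D : Dims}
    {gs gφ gt : Label → ℝ → ℝ → ℝ} {l lam : Fin 4 → ℝ} {c : ℝ}
    (h : 0 ≤ l ⬝ᵥ (alphaMat α (Vext D gs gφ gt) *ᵥ l)) (hlam : lam = c • l) :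
    0 ≤ α (quadVext D lam gs gφ gt) := by
  rw [hlam, quadVext_smul, map_smul, smul_eq_mul]
  rw [alphaMat_quadForm] at h
  exact mul_nonneg (sq_nonneg c) h

/-- The weaker condition depends only on the class: for `c ≠ 0` it holds at `c l` iff it holds at `l` (footnote:
"`λ_ext` can be any representative of the equivalence class"). [cite: ChesterEtAl2020, §3.2 (weaker condition, footnote)] -/
theorem extWeak_smul_iff (α : (ℝ → ℝ → Fin 22 → ℝ) →ₗ[ℝ] ℝ) {D : Dims}
    {gs gφ gt : Label → ℝ → ℝ → ℝ} (l : Fin 4 → ℝ) {c : ℝ} (hc : c ≠ 0) :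
    0 ≤ (c • l) ⬝ᵥ (alphaMat α (Vext D gs gφ gt) *ᵥ (c • l)) ↔
      0 ≤ l ⬝ᵥ (alphaMat α (Vext D gs gφ gt) *ᵥ l) := by
  rw [alphaMat_quadForm, alphaMat_quadForm, ← quadVext, ← quadVext, quadVext_smul, map_smul,
    smul_eq_mul]
  exact mul_nonneg_iff_of_pos_left (by positivity)

/-- The strong condition implies the weaker one for every class — whence *"the union of the resulting allowed
regions must be contained inside the original allowed region"*. [cite: ChesterEtAl2020, §3.2 (union ⊆ naive region)] -/
theorem extWeak_of_posSemidef (α : (ℝ → ℝ → Fin 22 → ℝ) →ₗ[ℝ] ℝ) {D : Dims}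
    {gs gφ gt : Label → ℝ → ℝ → ℝ} (h : (alphaMat α (Vext D gs gφ gt)).PosSemidef) (l : Fin 4 → ℝ) :
    0 ≤ l ⬝ᵥ (alphaMat α (Vext D gs gφ gt) *ᵥ l) := by
  have := h.dotProduct_mulVec_nonneg l
  rwa [star_trivial] at this

/-- **The scan logic**: if for every class `[l] ∈ ℝP³` (every `l ≠ 0`) something — "a functional obeying the
conditions with the weaker one at `l` exists" — rules out every spectrum whose `λ_ext` lies on the line `ℝ l`,
then the spectrum is ruled out whatever its `λ_ext` (for `λ_ext = 0` any class serves, with `c = 0`):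
*"If `α` exists for all `[λ_ext]`, then the point is disallowed."* [cite: ChesterEtAl2020, §3.3 (disallowed iff excluded for all classes)] -/
theorem false_of_forall_class {P : (Fin 4 → ℝ) → Prop} (lam : Fin 4 → ℝ) (hscan : ∀ l, l ≠ 0 → P l)
    (hdata : ∀ (l : Fin 4 → ℝ) (c : ℝ), l ≠ 0 → lam = c • l → ¬P l) : False := by
  by_cases h : lam = 0
  · have h1 : (![1, 0, 0, 0] : Fin 4 → ℝ) ≠ 0 := fun h0 => by simpa using congrFun h0 0
    exact hdata _ 0 h1 (by rw [h, zero_smul]) (hscan _ h1)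
  · exact hdata lam 1 h (by rw [one_smul]) (hscan lam h)

/-! ## 7. The exclusion step -/

/-- **The exclusion argument** (abstract form, verbatim logic of §3.1 with §3.2 for the externals).  Data: the
seven families of exchanged operators OTHER than the unit and the three externals — `0⁺` (`ι0p`: couplings
`(λ_{ss}, λ_{φφ}, λ_{tt}) = (a0, b0, c0)`, blocks `g0p`), `0⁻` (`ι0m`: `(λ_{φφ}, λ_{tt})`), charge `1` (`ι1`:
`(λ_{φs}, λ_{tφ})`, signs `ε1`), `2⁺` (`ι2p`: `(λ_{φφ}, λ_{ts})`), `2⁻` (`ι2m`: weights `λ²_{ts} = p2m ≥ 0`), `3`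
(`ι3`: `λ²_{tφ} = p3 ≥ 0`, signs `ε3`), `4` (`ι4`: `λ²_{tt} = p4 ≥ 0`); the external couplings `lam = λ_ext` with
the blocks `gs, gφ, gt` of `s, φ, t`.  Hypotheses: `α` APPLIES TERMWISE to each sector series (`h0p … h4`, sums
`A0p … A4` — automatic for point functionals, `hasSum_pointFunctional₂₂`); `α` annihilates the crossing
equation, written as unit + externals + the seven sector sums (`hzero`); the conditions of §3.1 — unit
normalisation `(1 1 1) α(V⃗_{0⁺,0,0}) (1;1;1) > 0` (any positive normalisation), `α(V⃗_{0⁺}) ⪰ 0`, `α(V⃗_{0⁻}) ⪰ 0`,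
`α(V⃗_1) ⪰ 0`, `α(V⃗_{2⁺}) ⪰ 0` on the exchanged operators, `α(V⃗_{2⁻}), α(V⃗_3), α(V⃗_4) ≥ 0`; and the external term
signed, `0 ≤ α(λ_extᵀ V⃗_ext λ_ext)` (from `α(V⃗_ext) ⪰ 0` by `ext_nonneg_of_posSemidef`, or from the weaker
condition at the class of `λ_ext` by `ext_nonneg_of_weak`).  Conclusion: contradiction.
[cite: ChesterEtAl2020, §3.1 (functional conditions; "the hypothetical spectrum is ruled out")] -/
theorem false_of_functional₂₂ (α : (ℝ → ℝ → Fin 22 → ℝ) →ₗ[ℝ] ℝ) (D : Dims)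
    {ι0p ι0m ι1 ι2p ι2m ι3 ι4 : Type*}
    {a0 b0 c0 : ι0p → ℝ} {g0p : ι0p → Label → ℝ → ℝ → ℝ}
    {b0m c0m : ι0m → ℝ} {g0m : ι0m → Label → ℝ → ℝ → ℝ}
    {x1 y1 ε1 : ι1 → ℝ} {g1 : ι1 → Label → ℝ → ℝ → ℝ}
    {b2 z2 : ι2p → ℝ} {g2p : ι2p → Label → ℝ → ℝ → ℝ}
    {p2m : ι2m → ℝ} {g2m : ι2m → Label → ℝ → ℝ → ℝ}
    {p3 ε3 : ι3 → ℝ} {g3 : ι3 → Label → ℝ → ℝ → ℝ}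
    {p4 : ι4 → ℝ} {g4 : ι4 → Label → ℝ → ℝ → ℝ}
    {lam : Fin 4 → ℝ} {gs gφ gt : Label → ℝ → ℝ → ℝ} {A0p A0m A1 A2p A2m A3 A4 : ℝ}
    (hp2m : ∀ o, 0 ≤ p2m o) (hp3 : ∀ o, 0 ≤ p3 o) (hp4 : ∀ o, 0 ≤ p4 o)
    (h0p : HasSum (fun o => α (quad0p D (a0 o) (b0 o) (c0 o) (g0p o))) A0p)
    (h0m : HasSum (fun o => α (quad0m D (b0m o) (c0m o) (g0m o))) A0m)
    (h1 : HasSum (fun o => α (quad1 D (x1 o) (y1 o) (ε1 o) (g1 o))) A1)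
    (h2p : HasSum (fun o => α (quad2p D (b2 o) (z2 o) (g2p o))) A2p)
    (h2m : HasSum (fun o => p2m o * α (V2m D (g2m o))) A2m)
    (h3 : HasSum (fun o => p3 o * α (V3 D (ε3 o) (g3 o))) A3)
    (h4 : HasSum (fun o => p4 o * α (V4 D (g4 o))) A4)
    (hzero : α (quad0p D 1 1 1 unitBlocks) + α (quadVext D lam gs gφ gt) +
      A0p + A0m + A1 + A2p + A2m + A3 + A4 = 0)
    (hunit : 0 < ![(1 : ℝ), 1, 1] ⬝ᵥ (alphaMat α (V0p D unitBlocks) *ᵥ ![(1 : ℝ), 1, 1]))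
    (hext : 0 ≤ α (quadVext D lam gs gφ gt))
    (hpos0p : ∀ o, (alphaMat α (V0p D (g0p o))).PosSemidef)
    (hpos0m : ∀ o, (alphaMat α (V0m D (g0m o))).PosSemidef)
    (hpos1 : ∀ o, (alphaMat α (V1 D (ε1 o) (g1 o))).PosSemidef)
    (hpos2p : ∀ o, (alphaMat α (V2p D (g2p o))).PosSemidef)
    (hpos2m : ∀ o, 0 ≤ α (V2m D (g2m o))) (hpos3 : ∀ o, 0 ≤ α (V3 D (ε3 o) (g3 o)))
    (hpos4 : ∀ o, 0 ≤ α (V4 D (g4 o))) : False := by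
  have n0p : 0 ≤ A0p := h0p.nonneg fun o => quadVec_nonneg_of_posSemidef α (hpos0p o) _
  have n0m : 0 ≤ A0m := h0m.nonneg fun o => quadVec_nonneg_of_posSemidef α (hpos0m o) _
  have n1 : 0 ≤ A1 := h1.nonneg fun o => quadVec_nonneg_of_posSemidef α (hpos1 o) _
  have n2p : 0 ≤ A2p := h2p.nonneg fun o => quadVec_nonneg_of_posSemidef α (hpos2p o) _
  have n2m : 0 ≤ A2m := h2m.nonneg fun o => mul_nonneg (hp2m o) (hpos2m o)
  have n3 : 0 ≤ A3 := h3.nonneg fun o => mul_nonneg (hp3 o) (hpos3 o)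
  have n4 : 0 ≤ A4 := h4.nonneg fun o => mul_nonneg (hp4 o) (hpos4 o)
  rw [alpha_quad0p] at hunit
  linarith

/-- A finite combination of point evaluations of the 22 components, `α(F) = Σ_m Σ_r w m r · F(u_m, v_m)_r` — the
22-component analogue of `pointFunctional₇`. [cite: HogervorstRychkov2013, §4.3]
[cite: ChesterEtAl2020, §3.1 (functional conditions)] -/
def pointFunctional₂₂ {M : ℕ} (w : Fin M → Fin 22 → ℝ) (u v : Fin M → ℝ) :
    (ℝ → ℝ → Fin 22 → ℝ) →ₗ[ℝ] ℝ where
  toFun F := ∑ m, ∑ r, w m r * F (u m) (v m) r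
  map_add' F F' := by
    simp only [Pi.add_apply, mul_add, Finset.sum_add_distrib]
  map_smul' c F := by
    simp only [Pi.smul_apply, smul_eq_mul, RingHom.id_apply, Finset.mul_sum]
    refine Finset.sum_congr rfl fun m _ => Finset.sum_congr rfl fun r _ => ?_
    ring

/-- Unfolding of `pointFunctional₂₂`. [cite: HogervorstRychkov2013, §4.3] -/
theorem pointFunctional₂₂_apply {M : ℕ} (w : Fin M → Fin 22 → ℝ) (u v : Fin M → ℝ)
    (F : ℝ → ℝ → Fin 22 → ℝ) :
    pointFunctional₂₂ w u v F = ∑ m, ∑ r, w m r * F (u m) (v m) r := rfl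

/-- Point functionals apply termwise: pointwise convergence of a 22-vector-valued series at the evaluation points
gives convergence of the applied series, with no further hypothesis.
[cite: ChesterEtAl2020, §3.1 (functional conditions)] -/
theorem hasSum_pointFunctional₂₂ {M : ℕ} (w : Fin M → Fin 22 → ℝ) (u v : Fin M → ℝ) {ι : Type*}
    {f : ι → ℝ → ℝ → Fin 22 → ℝ} {F : ℝ → ℝ → Fin 22 → ℝ}
    (h : ∀ m, HasSum (fun o => f o (u m) (v m)) (F (u m) (v m))) :
    HasSum (fun o => pointFunctional₂₂ w u v (f o)) (pointFunctional₂₂ w u v F) := by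
  simp only [pointFunctional₂₂_apply]
  refine hasSum_sum fun m _ => hasSum_sum fun r _ => ?_
  exact ((Pi.hasSum.mp (h m)) r).mul_left (w m r)

/-- **Exclusion by a point functional, all hypotheses explicit.**  Data as in `false_of_functional₂₂`, evaluation
points `(u_m, v_m)`, and seven functions `T0p … T4` whose values at the evaluation points are the sums of the
seven sector series there (`h0p … h4`: the series of 22-vectors converge at every `(u_m, v_m)`).  Hypotheses:
the crossing equation holds at every evaluation point in the grouped form "unit + `λ_extᵀ V⃗_ext λ_ext` + the
seven sector sums `= 0`" (`hx`); and for `α = pointFunctional₂₂ w u v` the conditions of §3.1 with, for the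
externals, the weaker condition of §3.2 at a representative `l` of the class of `λ_ext = c l` (`hext`, `hlam`;
`c = 0` covers `λ_ext = 0`).  Conclusion: contradiction — the hypothetical spectrum is ruled out.
[cite: ChesterEtAl2020, §3.1 (functional conditions), §3.2 (weaker condition)] -/
theorem false_of_pointFunctional₂₂ {M : ℕ} (w : Fin M → Fin 22 → ℝ) (u v : Fin M → ℝ) (D : Dims)
    {ι0p ι0m ι1 ι2p ι2m ι3 ι4 : Type*}
    {a0 b0 c0 : ι0p → ℝ} {g0p : ι0p → Label → ℝ → ℝ → ℝ}
    {b0m c0m : ι0m → ℝ} {g0m : ι0m → Label → ℝ → ℝ → ℝ}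
    {x1 y1 ε1 : ι1 → ℝ} {g1 : ι1 → Label → ℝ → ℝ → ℝ}
    {b2 z2 : ι2p → ℝ} {g2p : ι2p → Label → ℝ → ℝ → ℝ}
    {p2m : ι2m → ℝ} {g2m : ι2m → Label → ℝ → ℝ → ℝ}
    {p3 ε3 : ι3 → ℝ} {g3 : ι3 → Label → ℝ → ℝ → ℝ}
    {p4 : ι4 → ℝ} {g4 : ι4 → Label → ℝ → ℝ → ℝ}
    {lam l : Fin 4 → ℝ} {c : ℝ} {gs gφ gt : Label → ℝ → ℝ → ℝ}
    {T0p T0m T1 T2p T2m T3 T4 : ℝ → ℝ → Fin 22 → ℝ}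
    (hp2m : ∀ o, 0 ≤ p2m o) (hp3 : ∀ o, 0 ≤ p3 o) (hp4 : ∀ o, 0 ≤ p4 o)
    (h0p : ∀ m, HasSum (fun o => quad0p D (a0 o) (b0 o) (c0 o) (g0p o) (u m) (v m)) (T0p (u m) (v m)))
    (h0m : ∀ m, HasSum (fun o => quad0m D (b0m o) (c0m o) (g0m o) (u m) (v m)) (T0m (u m) (v m)))
    (h1 : ∀ m, HasSum (fun o => quad1 D (x1 o) (y1 o) (ε1 o) (g1 o) (u m) (v m)) (T1 (u m) (v m)))
    (h2p : ∀ m, HasSum (fun o => quad2p D (b2 o) (z2 o) (g2p o) (u m) (v m)) (T2p (u m) (v m)))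
    (h2m : ∀ m, HasSum (fun o => p2m o • V2m D (g2m o) (u m) (v m)) (T2m (u m) (v m)))
    (h3 : ∀ m, HasSum (fun o => p3 o • V3 D (ε3 o) (g3 o) (u m) (v m)) (T3 (u m) (v m)))
    (h4 : ∀ m, HasSum (fun o => p4 o • V4 D (g4 o) (u m) (v m)) (T4 (u m) (v m)))
    (hx : ∀ m, quad0p D 1 1 1 unitBlocks (u m) (v m) + quadVext D lam gs gφ gt (u m) (v m) +
      T0p (u m) (v m) + T0m (u m) (v m) + T1 (u m) (v m) + T2p (u m) (v m) + T2m (u m) (v m) +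
      T3 (u m) (v m) + T4 (u m) (v m) = 0)
    (hunit : 0 < ![(1 : ℝ), 1, 1] ⬝ᵥ
      (alphaMat (pointFunctional₂₂ w u v) (V0p D unitBlocks) *ᵥ ![(1 : ℝ), 1, 1]))
    (hext : 0 ≤ l ⬝ᵥ (alphaMat (pointFunctional₂₂ w u v) (Vext D gs gφ gt) *ᵥ l)) (hlam : lam = c • l)
    (hpos0p : ∀ o, (alphaMat (pointFunctional₂₂ w u v) (V0p D (g0p o))).PosSemidef)
    (hpos0m : ∀ o, (alphaMat (pointFunctional₂₂ w u v) (V0m D (g0m o))).PosSemidef)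
    (hpos1 : ∀ o, (alphaMat (pointFunctional₂₂ w u v) (V1 D (ε1 o) (g1 o))).PosSemidef)
    (hpos2p : ∀ o, (alphaMat (pointFunctional₂₂ w u v) (V2p D (g2p o))).PosSemidef)
    (hpos2m : ∀ o, 0 ≤ pointFunctional₂₂ w u v (V2m D (g2m o)))
    (hpos3 : ∀ o, 0 ≤ pointFunctional₂₂ w u v (V3 D (ε3 o) (g3 o)))
    (hpos4 : ∀ o, 0 ≤ pointFunctional₂₂ w u v (V4 D (g4 o))) : False := by
  set α := pointFunctional₂₂ w u v with hα
  refine false_of_functional₂₂ α D (a0 := a0) (b0 := b0) (c0 := c0) (b0m := b0m) (c0m := c0m)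
    (x1 := x1) (y1 := y1) (b2 := b2) (z2 := z2) (A0p := α T0p) (A0m := α T0m) (A1 := α T1)
    (A2p := α T2p) (A2m := α T2m) (A3 := α T3) (A4 := α T4) (lam := lam) (gs := gs) (gφ := gφ)
    (gt := gt) hp2m hp3 hp4 ?_ ?_ ?_ ?_ ?_ ?_ ?_ ?_ hunit (ext_nonneg_of_weak α hext hlam) hpos0p
    hpos0m hpos1 hpos2p hpos2m hpos3 hpos4
  · exact hasSum_pointFunctional₂₂ w u v (f := fun o => quad0p D (a0 o) (b0 o) (c0 o) (g0p o)) h0p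
  · exact hasSum_pointFunctional₂₂ w u v (f := fun o => quad0m D (b0m o) (c0m o) (g0m o)) h0m
  · exact hasSum_pointFunctional₂₂ w u v (f := fun o => quad1 D (x1 o) (y1 o) (ε1 o) (g1 o)) h1
  · exact hasSum_pointFunctional₂₂ w u v (f := fun o => quad2p D (b2 o) (z2 o) (g2p o)) h2p
  · have := hasSum_pointFunctional₂₂ w u v (f := fun o => p2m o • V2m D (g2m o)) (F := T2m) h2m
    simpa [map_smul, smul_eq_mul] using this
  · have := hasSum_pointFunctional₂₂ w u v (f := fun o => p3 o • V3 D (ε3 o) (g3 o)) (F := T3) h3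
    simpa [map_smul, smul_eq_mul] using this
  · have := hasSum_pointFunctional₂₂ w u v (f := fun o => p4 o • V4 D (g4 o)) (F := T4) h4
    simpa [map_smul, smul_eq_mul] using this
  · -- the crossing equation holds at every evaluation point
    have hsum : α (quad0p D 1 1 1 unitBlocks + quadVext D lam gs gφ gt + T0p + T0m + T1 + T2p +
        T2m + T3 + T4) = 0 := by
      rw [hα, pointFunctional₂₂_apply]
      refine Finset.sum_eq_zero fun m _ => Finset.sum_eq_zero fun r _ => ?_
      have := congrFun (hx m) r
      simp only [Pi.add_apply, Pi.zero_apply] at this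
      simp only [Pi.add_apply, this, mul_zero]
    simpa only [map_add] using hsum

end Literature.MathematicalPhysics.QuantumFieldTheory.O2ThreeScalarCrossing

end
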